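import Mathlib.Analysis.Calculus.MeanValue
import Literature.Geometry.Lorentzian.GeodesicExtension
import Literature.Geometry.Lorentzian.GeodesicUniformTime
import Literature.Geometry.Lorentzian.GeodesicSpeed
import HarnessLib

/-!
# Gordon's completeness criterion: a proper function with bounded gradient

For a `C^n` Riemannian metric `g` (`n ≥ 2`, so that the Levi-Civita connection is `C¹`) on a
Hausdorff, locally compact manifold `M` without boundary (finite-dimensional complete model
space), this file proves the sufficiency half of **Gordon's criterion** (W. B. Gordon, *An
analytical criterion for the completeness of Riemannian manifolds*, Proc. Amer. Math. Soc. 37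
(1973) 221–225, Theorem: a Riemannian manifold is complete if (and only if) it carries a proper
function whose gradient is bounded in length), in the form needed downstream and without the
Hopf–Rinow theorem: *if `M` carries a differentiable function `ρ` with `|dρ(v)| ≤ L |v|_g` whose
sublevel sets `{ρ ≤ s}` are relatively compact, then the Levi-Civita connection of `g` is
geodesically complete* (`PseudoRiemannianMetric.isGeodesicallyComplete_of_properFunction`).

## Proof

The completeness criterion `isGeodesicallyComplete_of_uniformTime` of `GeodesicExtension.lean`
asks, for initial data `(x, v)` and a time bound `T`, for a set `𝒦 ⊆ TM` with a uniform
existence time containing the tangent lifts `(γ t, γ' t)`, `|t| < T`, of all geodesics through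
`(x, v)`. Here `𝒦` is a compact set containing `{p ∈ TM | π p ∈ K, g(p, p) ≤ C}`
(`exists_isCompact_tangent_superset`: over a compact neighbourhood inside a trivialising chart
the `g`-short vectors are bounded in the chart norm, by compactness and positivity of `g` on the
chart sphere bundle; finitely many charts cover `K`), which has a uniform existence time by
`exists_uniform_isGeodesicOn_of_isCompact` (`GeodesicUniformTime.lean`). Confinement: along a
geodesic `g(γ', γ')` is constant (`GeodesicSpeed.lean`), equal to `C = g(v, v)`, and
`(d/dt) ρ(γ t) = dρ(γ' t)` is bounded by `L √C`, so `ρ(γ t) ≤ ρ(x) + L √C |t| < ρ(x) + L √C T`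
(mean value inequality, `apply_le_add_of_mfderiv_le`) and `γ t` stays in the compact set
`K ⊇ {ρ ≤ ρ(x) + L √C T}`. This is Gordon's argument (loc. cit., proof of the Theorem: the length
of `∇f` being bounded, `f` grows at most linearly in arc length, so a geodesic of finite length
stays in a compact sublevel set of the proper function `f`, where it can be continued), with the
continuation supplied by the uniform existence time.

## References

* W. B. Gordon, *An analytical criterion for the completeness of Riemannian manifolds*, Proc.
  Amer. Math. Soc. 37 (1973) 221–225 (and corrections, ibid. 45 (1974) 130–131): Theorem.
* B. O'Neill, *Semi-Riemannian geometry with applications to relativity*, Academic Press 1983,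
  Ch. 5, Lemma 8 (p. 130).
* J. M. Lee, *Introduction to Riemannian Manifolds*, 2nd ed., Springer GTM 176 (2018),
  Lemma 6.19, Cor. 6.20.
-/

noncomputable section

open Bundle Set Filter Metric
open scoped Manifold ContDiff Topology

namespace Literature.Geometry.Lorentzian

variable {E : Type*} [NormedAddCommGroup E] [NormedSpace ℝ E] {H : Type*} [TopologicalSpace H]
  {I : ModelWithCorners ℝ E H} {M : Type*} [TopologicalSpace M] [ChartedSpace H M]
  [IsManifold I ∞ M] {n : ℕ∞ω}

namespace PseudoRiemannianMetric

variable (g : PseudoRiemannianMetric I n E (TangentSpace I : M → Type _))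

/-! ### Growth of a function with bounded gradient along a curve of bounded speed -/

/-- **Linear growth along curves of bounded speed** (the estimate in Gordon's proof, Proc. AMS 37
(1973), p. 222: `|f(γ(t)) - f(γ(0))| ≤ sup |∇f| · length`). If `ρ : M → ℝ` is differentiable with
`|dρ_q(v)| ≤ L √(g_q(v, v))` for all `q, v` (`L ≥ 0`; `dρ = mvfderiv I ρ`, the differential as a covector), and `γ` is a curve differentiable on the
interval `(a, b) ∋ 0` with `g(γ' t, γ' t) ≤ C` there, then `ρ(γ t) ≤ ρ(γ 0) + L √C |t|` for
`t ∈ (a, b)`: the derivative of `t ↦ ρ(γ t)` is `dρ(γ' t)` (chain rule), bounded by `L √C`, and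
the mean value inequality applies on the convex set `(a, b)`.
[cite: Gordon1973, Theorem (proof)] -/
theorem apply_le_add_of_mfderiv_le {ρ : M → ℝ} {L C : ℝ} (hL : 0 ≤ L)
    (hρ : ∀ q, MDifferentiableAt I 𝓘(ℝ, ℝ) ρ q)
    (hdρ : ∀ (q) (v : TangentSpace I q),
      |mvfderiv I ρ q v| ≤ L * Real.sqrt (g.val q v v))
    {γ : ℝ → M} {a b : ℝ} (h0 : (0 : ℝ) ∈ Ioo a b)
    (hγd : ∀ t ∈ Ioo a b, MDifferentiableAt 𝓘(ℝ, ℝ) I γ t)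
    (hγC : ∀ t ∈ Ioo a b, g.val (γ t) (velocity I γ t) (velocity I γ t) ≤ C)
    {t : ℝ} (ht : t ∈ Ioo a b) :
    ρ (γ t) ≤ ρ (γ 0) + L * Real.sqrt C * |t| := by
  have hder : ∀ τ ∈ Ioo a b, HasDerivWithinAt (fun τ ↦ ρ (γ τ))
      (mvfderiv I ρ (γ τ) (velocity I γ τ)) (Ioo a b) τ := fun τ hτ ↦
    (hasDerivAt_comp_curve (hρ _) (hγd τ hτ)).hasDerivWithinAt
  have hbound : ∀ τ ∈ Ioo a b,
      ‖mvfderiv I ρ (γ τ) (velocity I γ τ)‖ ≤ L * Real.sqrt C := by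
    intro τ hτ
    rw [Real.norm_eq_abs]
    exact (hdρ _ _).trans (mul_le_mul_of_nonneg_left (Real.sqrt_le_sqrt (hγC τ hτ)) hL)
  have h := (convex_Ioo a b).norm_image_sub_le_of_norm_hasDerivWithin_le hder hbound h0 ht
  rw [sub_zero, Real.norm_eq_abs, Real.norm_eq_abs] at h
  linarith [le_abs_self (ρ (γ t) - ρ (γ 0))]

/-! ### Compact sets of tangent vectors of bounded length -/

/-- The length function `p ↦ g_{π p}(p, p)` is continuous on the tangent bundle (the metric is a
`C^n` section of the bundle of bilinear forms; evaluate it on the identity section of `TM` over the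
projection, Mathlib's `ContMDiff.clm_bundle_apply₂`, and read off the fibre component of the
resulting map into the trivial line bundle). [folklore] -/
theorem continuous_val_tangentBundle :
    Continuous fun p : TangentBundle I M ↦ g.val p.proj p.2 p.2 := by
  have hψ : ContMDiff I.tangent (I.prod 𝓘(ℝ, E →L[ℝ] E →L[ℝ] ℝ)) n
      (fun p : TangentBundle I M ↦ TotalSpace.mk' (E →L[ℝ] E →L[ℝ] ℝ)
        (E := fun x : M ↦ TangentSpace I x →L[ℝ] TangentSpace I x →L[ℝ] ℝ)
        p.proj (g.val p.proj)) :=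
    g.contMDiff.comp (Bundle.contMDiff_proj (TangentSpace I : M → Type _))
  have hv : ContMDiff I.tangent I.tangent n
      (fun p : TangentBundle I M ↦ (TotalSpace.mk' E p.proj p.2 : TangentBundle I M)) :=
    contMDiff_id
  have h2 : ContMDiff I.tangent (I.prod 𝓘(ℝ, ℝ)) n
      (fun p : TangentBundle I M ↦
        TotalSpace.mk' ℝ (E := Bundle.Trivial M ℝ) p.proj (g.val p.proj p.2 p.2)) :=
    hψ.clm_bundle_apply₂ (F₁ := E) (F₂ := E) hv hv
  exact ((Bundle.Trivial.homeomorphProd M ℝ).continuous.comp h2.continuous).snd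

/-- **Compactness of the set of `g`-short vectors over a compact set** (the compactness of the
sphere bundle over a compact set used in the escape lemma, Lee, *Introduction to Riemannian
Manifolds* (2018), proof of Lemma 6.19; here for a positive definite `C^n` metric on a locally
compact manifold). For `K ⊆ M` compact and `C : ℝ` there is a compact `𝒦 ⊆ TM` containing every
`p ∈ TM` with `π p ∈ K` and `g(p, p) ≤ C`. Proof: over a compact neighbourhood `N` of a point
inside a trivialising chart `e` of `TM`, the continuous function `(y, w) ↦ g_y(e⁻¹ w, e⁻¹ w)` has
a positive minimum `m` on `N × {‖w‖ = 1}`, so `g(p, p) ≤ C` forces `‖e p‖² ≤ C / m` and `p` lies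
in the compact set `e⁻¹(N × closedBall 0 √(C/m))`; finitely many such `N` cover `K`.
[cite: Lee2018, Lemma 6.19 (proof)] -/
theorem exists_isCompact_tangent_superset [LocallyCompactSpace M] [FiniteDimensional ℝ E]
    (hpos : ∀ (x : M) (v : TangentSpace I x), v ≠ 0 → 0 < g.val x v v)
    {K : Set M} (hK : IsCompact K) (C : ℝ) :
    ∃ 𝒦 : Set (TangentBundle I M), IsCompact 𝒦 ∧
      ∀ p : TangentBundle I M, p.proj ∈ K → g.val p.proj p.2 p.2 ≤ C → p ∈ 𝒦 := by
  classical
  have hF := g.continuous_val_tangentBundle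
  -- the local statement near each point
  have hloc : ∀ x : M, ∃ N ∈ 𝓝 x, ∃ 𝒦 : Set (TangentBundle I M), IsCompact 𝒦 ∧
      ∀ p : TangentBundle I M, p.proj ∈ N → g.val p.proj p.2 p.2 ≤ C → p ∈ 𝒦 := by
    intro x
    set e := trivializationAt E (TangentSpace I : M → Type _) x with he_def
    have hxe : x ∈ e.baseSet := FiberBundle.mem_baseSet_trivializationAt' x
    obtain ⟨N, hN, hNe, hNc⟩ := local_compact_nhds (e.open_baseSet.mem_nhds hxe)
    -- the length function in the chart `e`
    set Φ : M × E → ℝ := fun yw ↦ g.val yw.1 (e.symm yw.1 yw.2) (e.symm yw.1 yw.2) with hΦ_def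
    have hΦc : ContinuousOn Φ (e.baseSet ×ˢ univ) := hF.comp_continuousOn e.continuousOn_symm
    have hΦsmul : ∀ y ∈ e.baseSet, ∀ (c : ℝ) (w : E), Φ (y, c • w) = c ^ 2 * Φ (y, w) := by
      intro y hy c w
      simp only [hΦ_def]
      rw [← e.symmL_apply (R := ℝ) hy, ← e.symmL_apply (R := ℝ) hy, map_smul]
      simp only [map_smul, smul_apply, smul_eq_mul]
      ring
    -- a positive lower bound on `N × sphere`
    obtain ⟨m, hm, hmΦ⟩ : ∃ m : ℝ, 0 < m ∧ ∀ yw ∈ N ×ˢ sphere (0 : E) 1, m ≤ Φ yw := by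
      by_cases hne : (N ×ˢ sphere (0 : E) 1).Nonempty
      · have hc : IsCompact (N ×ˢ sphere (0 : E) 1) := hNc.prod (isCompact_sphere 0 1)
        obtain ⟨yw₀, hyw₀, hmin⟩ :=
          hc.exists_isMinOn hne (hΦc.mono (prod_mono hNe (subset_univ _)))
        refine ⟨Φ yw₀, ?_, fun yw hyw ↦ hmin hyw⟩
        have hy₀ : yw₀.1 ∈ e.baseSet := hNe hyw₀.1
        have hw₀ : e.symm yw₀.1 yw₀.2 ≠ 0 := by
          intro h0
          have h2 : e.symmL ℝ yw₀.1 yw₀.2 = 0 := by rwa [e.symmL_apply (R := ℝ) hy₀]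
          have h3 := congrArg (e.continuousLinearMapAt ℝ yw₀.1) h2
          rw [e.continuousLinearMapAt_symmL hy₀, map_zero] at h3
          have h4 : ‖yw₀.2‖ = 1 := by simpa using hyw₀.2
          rw [h3, norm_zero] at h4
          exact zero_ne_one h4
        exact hpos _ _ hw₀
      · exact ⟨1, one_pos, fun yw hyw ↦ (hne ⟨yw, hyw⟩).elim⟩
    -- the chart norm of a `g`-short vector over `N` is bounded
    have hbd : ∀ p : TangentBundle I M, p.proj ∈ N → g.val p.proj p.2 p.2 ≤ C →
        ‖(e p).2‖ ^ 2 ≤ C / m := by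
      intro p hp hC
      have hpe : p.proj ∈ e.baseSet := hNe hp
      have hC0 : 0 ≤ C := by
        refine le_trans ?_ hC
        by_cases h0 : p.2 = 0
        · simp [h0]
        · exact (hpos _ _ h0).le
      set w : E := (e p).2 with hw_def
      by_cases hw0 : w = 0
      · rw [hw0, norm_zero, zero_pow two_ne_zero]
        positivity
      · have hsym : e.symm p.proj w = p.2 := e.symm_proj_apply p hpe
        have hwpos : 0 < ‖w‖ := norm_pos_iff.2 hw0
        set u : E := ‖w‖⁻¹ • w with hu_def
        have hu : u ∈ sphere (0 : E) 1 := by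
          rw [mem_sphere_zero_iff_norm, hu_def, norm_smul, norm_inv, norm_norm,
            inv_mul_cancel₀ hwpos.ne']
        have h1 : m ≤ Φ (p.proj, u) := hmΦ _ ⟨hp, hu⟩
        have h2 : Φ (p.proj, u) = ‖w‖⁻¹ ^ 2 * Φ (p.proj, w) := hΦsmul _ hpe _ _
        have h3 : Φ (p.proj, w) = g.val p.proj p.2 p.2 := by simp only [hΦ_def, hsym]
        rw [h2, h3] at h1
        have h4 : m * ‖w‖ ^ 2 ≤ C := by
          have h5 := mul_le_mul_of_nonneg_right h1 (sq_nonneg ‖w‖)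
          calc m * ‖w‖ ^ 2 ≤ ‖w‖⁻¹ ^ 2 * g.val p.proj p.2 p.2 * ‖w‖ ^ 2 := h5
            _ = g.val p.proj p.2 p.2 := by field_simp
            _ ≤ C := hC
        rw [le_div_iff₀ hm]
        linarith
    -- the compact set `e⁻¹ (N × closedBall)`
    refine ⟨N, hN, (fun yw : M × E ↦ (TotalSpace.mk' E yw.1 (e.symm yw.1 yw.2) : TangentBundle I M)) ''
      (N ×ˢ closedBall (0 : E) (Real.sqrt (C / m))), ?_, ?_⟩
    · exact (hNc.prod (isCompact_closedBall 0 _)).image_of_continuousOn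
        (e.continuousOn_symm.mono (prod_mono hNe (subset_univ _)))
    · intro p hp hC
      have hpe : p.proj ∈ e.baseSet := hNe hp
      have hps : p ∈ e.source := e.mem_source.2 hpe
      refine ⟨e p, ⟨?_, ?_⟩, ?_⟩
      · rw [e.coe_fst hps]
        exact hp
      · rw [mem_closedBall, dist_zero_right]
        calc ‖(e p).2‖ = Real.sqrt (‖(e p).2‖ ^ 2) := (Real.sqrt_sq (norm_nonneg _)).symm
          _ ≤ Real.sqrt (C / m) := Real.sqrt_le_sqrt (hbd p hp hC)
      · have hb : (e p).1 ∈ e.baseSet := by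
          rw [e.coe_fst hps]
          exact hpe
        show TotalSpace.mk (e p).1 (e.symm (e p).1 (e p).2) = p
        rw [e.mk_symm hb, Prod.mk.eta]
        exact e.toOpenPartialHomeomorph.left_inv hps
  -- cover `K` by finitely many such neighbourhoods
  choose N hN 𝒦 h𝒦 hmem using hloc
  obtain ⟨t, -, ht⟩ := hK.elim_nhds_subcover N fun x _ ↦ hN x
  refine ⟨⋃ x ∈ t, 𝒦 x, t.isCompact_biUnion fun x _ ↦ h𝒦 x, fun p hp hC ↦ ?_⟩
  obtain ⟨x, hx, hpx⟩ := mem_iUnion₂.1 (ht hp)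
  exact mem_iUnion₂.2 ⟨x, hx, hmem x p hpx hC⟩

/-! ### Gordon's criterion -/

/-- **Gordon's completeness criterion (sufficiency).** Gordon, Proc. Amer. Math. Soc. 37 (1973),
Theorem: *a Riemannian manifold is complete if and only if it supports a proper function whose
gradient is bounded in length* — here the "if" half, with geodesic completeness of the
Levi-Civita connection as the conclusion (so that no appeal to the Hopf–Rinow theorem is needed)
and with properness in the one-sided form that is used: let `g` be a positive definite `C^n`
metric, `n ≥ 2`, on a Hausdorff locally compact manifold without boundary, and let `ρ : M → ℝ`
be differentiable with `|dρ_q(v)| ≤ L √(g_q(v, v))` and with every sublevel set `{ρ ≤ s}`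
contained in a compact set; then `g.leviCivita` is geodesically complete. Proof (Gordon's, made
quantitative): apply `isGeodesicallyComplete_of_uniformTime` with, for data `(x, v)` and time
bound `T`, the compact set `𝒦 ⊇ {p | π p ∈ K, g(p,p) ≤ g(v,v)}` of
`exists_isCompact_tangent_superset`, `K ⊇ {ρ ≤ ρ x + L |v| T}` compact; `𝒦` has a uniform
existence time (`exists_uniform_isGeodesicOn_of_isCompact`), geodesics through `(x, v)` have
constant `g(γ', γ') = g(v, v)` (`val_velocity_eq_of_isGeodesicOn_holds`) and satisfy
`ρ(γ t) ≤ ρ x + L |v| |t|` (`apply_le_add_of_mfderiv_le`), so their tangent lifts for `|t| < T`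
lie in `𝒦`. [cite: Gordon1973, Theorem (sufficiency)] -/
theorem isGeodesicallyComplete_of_properFunction [CompleteSpace E] [T2Space M]
    [BoundarylessManifold I M] [LocallyCompactSpace M] [FiniteDimensional ℝ E] [Fact (1 ≤ n)]
    [g.HasLeviCivita] (hn : 2 ≤ n)
    (hpos : ∀ (x : M) (v : TangentSpace I x), v ≠ 0 → 0 < g.val x v v)
    {ρ : M → ℝ} {L : ℝ} (hL : 0 ≤ L) (hρ : ∀ q, MDifferentiableAt I 𝓘(ℝ, ℝ) ρ q)
    (hdρ : ∀ (q) (v : TangentSpace I q),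
      |mvfderiv I ρ q v| ≤ L * Real.sqrt (g.val q v v))
    (hproper : ∀ s : ℝ, ∃ K : Set M, IsCompact K ∧ ∀ q, ρ q ≤ s → q ∈ K) :
    IsGeodesicallyComplete g.leviCivita := by
  haveI : CovariantDerivative.ContMDiffCovariantDerivative g.leviCivita 1 :=
    ⟨g.isLocallyContMDiff_leviCivita_holds 1
      (by rw [show ((1 : ℕ∞) : ℕ∞ω) + 1 = 2 by norm_num]; exact hn) univ isOpen_univ⟩
  refine isGeodesicallyComplete_of_uniformTime fun x v T hT ↦ ?_
  obtain ⟨K, hK, hKρ⟩ := hproper (ρ x + L * Real.sqrt (g.val x v v) * T)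
  obtain ⟨𝒦, h𝒦, h𝒦mem⟩ := g.exists_isCompact_tangent_superset hpos hK (g.val x v v)
  obtain ⟨ε, hε, huni⟩ := exists_uniform_isGeodesicOn_of_isCompact (cov := g.leviCivita) h𝒦
  refine ⟨𝒦, ε, hε, huni, fun γ a b ha hb hγ h0 hv0 t ht htT ↦ ?_⟩
  subst h0
  have hspeed : ∀ τ ∈ Ioo a b,
      g.val (γ τ) (velocity I γ τ) (velocity I γ τ) = g.val (γ 0) v v := by
    intro τ hτ
    rw [← hv0]
    exact g.val_velocity_eq_of_isGeodesicOn_holds isOpen_Ioo Set.ordConnected_Ioo hγ hτ ⟨ha, hb⟩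
  refine h𝒦mem _ (hKρ _ ?_) (hspeed t ht).le
  have h1 := g.apply_le_add_of_mfderiv_le hL hρ hdρ ⟨ha, hb⟩
    (fun τ hτ ↦ IsGeodesicOn.mdifferentiableAt_holds hγ hτ) (fun τ hτ ↦ (hspeed τ hτ).le) ht
  have h2 : L * Real.sqrt (g.val (γ 0) v v) * |t| ≤ L * Real.sqrt (g.val (γ 0) v v) * T :=
    mul_le_mul_of_nonneg_left htT.le (mul_nonneg hL (Real.sqrt_nonneg _))
  exact h1.trans (by linarith)

end PseudoRiemannianMetric

end Literature.Geometry.Lorentzian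

end
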